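import Literature.NumberTheory.LFunctions.KMVCutoffW
import Literature.NumberTheory.LFunctions.Bettin2017HarmonicDampedTwist
import Literature.NumberTheory.EllipticCurves.RankinSelbergStripIntegral
import Mathlib.Analysis.SpecialFunctions.ImproperIntegrals
import HarnessLib

/-!
# KMV 2000 (21)–(22) at `k = 0`, proof file II: the series side
# `Σ_{n₁,n₂} λ_f(n₁)λ_f(n₂)(n₁n₂)^{-1/2} W(n₁n₂/q̂²) = 4π² ∫_0^∞ f(iy) (∫_{v>1/(Ny)} f(iv) dv) dy`
# (stub S4 of the fact skeleton `fricke-real-split` for `KMV2000.completedL_half_sq_eq`)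

Source: E. Kowalski, P. Michel, J. VanderKam, J. reine angew. Math. 526 (2000), (13) p. 9 and
(21)–(22) p. 12 [held: paper:doi-10-1515-crll-2000-074]. Cell landau-siegel / ls-inputs, H-AFE,
seat ls-inputs-Hafe-lead g0 (K-INPUTS-7 (3)). Proofs only.

Write `F(y) = f(iy) = Σ_n a_n e^{-2πny}` (`hasSum_imagAxis`) and, for `c > 0`,
`∫_c^∞ F = Σ_n a_n e^{-2πnc}/(2πn)` (`hasSum_integral_Ioi_imagAxis`). With the real form
`W(y) = ∫_0^∞ e^{-u-y/u} du` (`KMV2000.cutoffW`) one has the substitution identity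
`∫_0^∞ e^{-αy} e^{-β/y} dy = W(αβ)/α` (`integral_exp_neg_mul_mul_exp_neg_div`), whence
`∫_0^∞ a_{n₁} e^{-2πn₁y} · a_{n₂} e^{-2πn₂/(Ny)}/(2πn₂) dy = a_{n₁}a_{n₂} W(4π²n₁n₂/N)/(4π²n₁n₂)
= afeSqTerm N f (n₁,n₂) / 4π²` (`q̂² = N/4π²`, `λ_f(n) = a_n n^{-1/2}` = `Bettin2017.heckeLambda_weight_two`). Summing over `ℕ × ℕ` and
exchanging sum and integral (dominated: `W(y) ≤ 48/y²` and `Σ ‖a_n‖ n^{-3} < ∞` by Hecke's bound,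
`LSeriesSummable_cuspCoeff_gamma0` at `s = 3`) gives the `HasSum` statement `hasSum_afeSqTerm`.
-/

noncomputable section

open scoped Real
open Complex Set MeasureTheory Filter CongruenceSubgroup UpperHalfPlane
open Literature.NumberTheory.EllipticCurves.ModularForms

namespace Literature.NumberTheory.LFunctions.KMV2000

/-! ### The substitution identity for `W` -/

/-- For `α > 0`, `β ≥ 0`: `y ↦ e^{-αy} e^{-β/y}` is integrable on `(0, ∞)` (dominated by `e^{-αy}`).
[cite: KowalskiMichelVanderKam2000, (21) p. 12] -/
theorem integrableOn_exp_neg_mul_mul_exp_neg_div {α β : ℝ} (hα : 0 < α) (hβ : 0 ≤ β) :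
    IntegrableOn (fun y : ℝ ↦ Real.exp (-α * y) * Real.exp (-β / y)) (Ioi 0) := by
  have hcont : ContinuousOn (fun y : ℝ ↦ Real.exp (-α * y) * Real.exp (-β / y)) (Ioi 0) := by
    refine ContinuousOn.mul (by fun_prop) (Real.continuous_exp.comp_continuousOn ?_)
    exact continuousOn_const.div continuousOn_id fun u hu ↦ ne_of_gt hu
  refine Integrable.mono' (exp_neg_integrableOn_Ioi 0 hα)
    (hcont.aestronglyMeasurable measurableSet_Ioi) ?_
  refine (ae_restrict_iff' measurableSet_Ioi).mpr (ae_of_all _ fun y hy ↦ ?_)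
  rw [norm_mul, Real.norm_of_nonneg (Real.exp_pos _).le, Real.norm_of_nonneg (Real.exp_pos _).le]
  refine mul_le_of_le_one_right (Real.exp_pos _).le (Real.exp_le_one_iff.mpr ?_)
  rw [neg_div]
  exact neg_nonpos.mpr (div_nonneg hβ (le_of_lt hy))

/-- **Substitution identity**: `∫_0^∞ e^{-αy} e^{-β/y} dy = W(αβ)/α` for `α > 0` (`u = αy` in
`W(αβ) = ∫_0^∞ e^{-u-αβ/u} du`). [cite: KowalskiMichelVanderKam2000, (21) p. 12] -/
theorem integral_exp_neg_mul_mul_exp_neg_div {α : ℝ} (hα : 0 < α) (β : ℝ) :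
    ∫ y in Ioi (0 : ℝ), Real.exp (-α * y) * Real.exp (-β / y) = cutoffW (α * β) / α := by
  have h := integral_comp_mul_left_Ioi (fun u : ℝ ↦ Real.exp (-u - α * β / u)) 0 hα
  rw [mul_zero] at h
  have h2 : ∫ y in Ioi (0 : ℝ), Real.exp (-α * y) * Real.exp (-β / y) =
      ∫ y in Ioi (0 : ℝ), Real.exp (-(α * y) - α * β / (α * y)) := by
    refine setIntegral_congr_fun measurableSet_Ioi fun y hy ↦ ?_
    have hy' : (y : ℝ) ≠ 0 := ne_of_gt hy
    rw [← Real.exp_add]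
    congr 1
    field_simp
    ring
  rw [h2, h, smul_eq_mul, cutoffW]
  field_simp

/-- Polynomial decay of `W`: `W(y) ≤ 48/y²` for `y > 0` (from `W(y) ≤ 2e^{-√y}` and
`e^{-x} ≤ 4!/x⁴`). [cite: KowalskiMichelVanderKam2000, (22) p. 12] -/
theorem cutoffW_le_div_sq {y : ℝ} (hy : 0 < y) : cutoffW y ≤ 48 / y ^ 2 := by
  have h1 := cutoffW_le_two_mul_exp_neg_sqrt hy.le
  have hs : 0 < Real.sqrt y := Real.sqrt_pos.mpr hy
  have h2 : Real.sqrt y ^ 4 / 24 ≤ Real.exp (Real.sqrt y) := by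
    have := Real.pow_div_factorial_le_exp (x := Real.sqrt y) hs.le 4
    norm_num [Nat.factorial] at this
    exact this
  have h3 : Real.exp (-Real.sqrt y) ≤ 24 / Real.sqrt y ^ 4 := by
    rw [Real.exp_neg, inv_eq_one_div, div_le_div_iff₀ (Real.exp_pos _) (by positivity)]
    linarith
  have h4 : Real.sqrt y ^ 4 = y ^ 2 := by
    rw [show (4 : ℕ) = 2 * 2 from rfl, pow_mul, Real.sq_sqrt hy.le]
  rw [h4] at h3
  calc cutoffW y ≤ 2 * Real.exp (-Real.sqrt y) := h1
    _ ≤ 2 * (24 / y ^ 2) := by gcongr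
    _ = 48 / y ^ 2 := by ring

/-! ### The summand in terms of the Fourier coefficients -/

variable {N : ℕ}

/-- `q̂² = N / 4π²`. [cite: KowalskiMichelVanderKam2000, §1 p. 1 (definition of q̂)] -/
theorem qhat_sq : qhat N ^ 2 = (N : ℝ) / (4 * π ^ 2) := by
  rw [qhat, div_pow, Real.sq_sqrt (Nat.cast_nonneg N)]
  ring

variable [NeZero N]

/-- For `n₁, n₂ ≥ 1`: `afeSqTerm N f (n₁,n₂) = a_{n₁} a_{n₂} · W(4π²n₁n₂/N) / (n₁n₂)`.
[cite: KowalskiMichelVanderKam2000, (21) p. 12] -/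
theorem afeSqTerm_eq_of_ne_zero (f : CuspForm (Gamma0 N) 2) {n₁ n₂ : ℕ} (h₁ : n₁ ≠ 0) (h₂ : n₂ ≠ 0) :
    afeSqTerm N f (n₁, n₂) =
      cuspCoeff f n₁ * cuspCoeff f n₂ *
        ((cutoffW (4 * π ^ 2 * n₁ * n₂ / N) / ((n₁ : ℝ) * n₂) : ℝ) : ℂ) := by
  have hn₁ : (0 : ℝ) < n₁ := by exact_mod_cast Nat.pos_of_ne_zero h₁
  have hn₂ : (0 : ℝ) < n₂ := by exact_mod_cast Nat.pos_of_ne_zero h₂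
  have hN : (0 : ℝ) < N := by exact_mod_cast NeZero.pos N
  have harg : (n₁ : ℝ) * n₂ / qhat N ^ 2 = 4 * π ^ 2 * n₁ * n₂ / N := by
    rw [qhat_sq]
    field_simp
  have hpow : (n₁ : ℝ) ^ (-(1 / 2 : ℝ)) * (n₂ : ℝ) ^ (-(1 / 2 : ℝ)) * ((n₁ : ℝ) * n₂) ^ (-(1 / 2 : ℝ)) =
      1 / ((n₁ : ℝ) * n₂) := by
    rw [← Real.mul_rpow hn₁.le hn₂.le, ← Real.rpow_add (mul_pos hn₁ hn₂),
      show (-(1 / 2 : ℝ)) + -(1 / 2) = -1 by norm_num, Real.rpow_neg_one, one_div]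
  simp only [afeSqTerm, Bettin2017.heckeLambda_weight_two, harg]
  push_cast
  have : (((n₁ : ℝ) ^ (-(1 / 2 : ℝ)) : ℝ) : ℂ) * (((n₂ : ℝ) ^ (-(1 / 2 : ℝ)) : ℝ) : ℂ) *
      ((((n₁ : ℝ) * n₂) ^ (-(1 / 2 : ℝ)) : ℝ) : ℂ) = 1 / ((n₁ : ℂ) * n₂) := by
    have h := congrArg (fun x : ℝ ↦ (x : ℂ)) hpow
    push_cast at h
    exact h
  linear_combination (cuspCoeff f n₁ * cuspCoeff f n₂ *
    (cutoffW (4 * π ^ 2 * n₁ * n₂ / N) : ℂ)) * this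

/-! ### The main computation

Inside the proof, `G (n₁,n₂) y = a_{n₁} e^{-2πn₁y} · a_{n₂} e^{-2πn₂/(Ny)}/(2πn₂)` is the `(n₁,n₂)` term of
the double series under the `y`-integral. -/

/-- **The series side of KMV (21)–(22) at `k = 0`**: for every `f ∈ S₂(Γ₀(N))`,
`Σ_{(n₁,n₂) ∈ ℕ×ℕ} λ_f(n₁)λ_f(n₂)(n₁n₂)^{-1/2} W(n₁n₂/q̂²) = 4π² ∫_0^∞ f(iy) (∫_{v>1/(Ny)} f(iv) dv) dy`
as a `HasSum` (so the double series converges absolutely). [cite: KowalskiMichelVanderKam2000, (21)–(22) p. 12] -/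
theorem hasSum_afeSqTerm (f : CuspForm (Gamma0 N) 2) :
    HasSum (afeSqTerm N f)
      (4 * (π : ℂ) ^ 2 *
        ∫ y in Ioi (0 : ℝ), f (UpperHalfPlane.ofComplex (Complex.I * y)) *
          ∫ v in Ioi (((N : ℝ) * y)⁻¹), f (UpperHalfPlane.ofComplex (Complex.I * v))) := by
  have hN : (0 : ℝ) < N := by exact_mod_cast NeZero.pos N
  have h0 : cuspCoeff f 0 = 0 := cuspCoeff_zero one_mem_strictPeriods_Gamma0 f
  -- the terms
  set G : ℕ × ℕ → ℝ → ℂ := fun p y ↦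
    (cuspCoeff f p.1 * (Real.exp (-(2 * Real.pi * p.1) * y) : ℝ)) *
      (cuspCoeff f p.2 *
        (Real.exp (-(2 * Real.pi * p.2) * ((N : ℝ) * y)⁻¹) / (2 * Real.pi * p.2) : ℝ)) with hG_def
  -- real core of `G` on `y > 0`
  have G_eq : ∀ (p : ℕ × ℕ) {y : ℝ}, 0 < y →
      G p y = cuspCoeff f p.1 * cuspCoeff f p.2 * (((2 * Real.pi * p.2)⁻¹ *
        (Real.exp (-(2 * Real.pi * p.1) * y) * Real.exp (-(2 * Real.pi * p.2 / N) / y)) : ℝ) : ℂ) := by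
    intro p y hy
    have hy' : y ≠ 0 := hy.ne'
    have harg : -(2 * Real.pi * (p.2 : ℝ)) * ((N : ℝ) * y)⁻¹ = -(2 * Real.pi * p.2 / N) / y := by
      field_simp
    simp only [hG_def, harg]
    push_cast
    ring
  -- terms with `n₁ = 0` or `n₂ = 0` vanish identically
  have G_fst_zero : ∀ n₂ : ℕ, G (0, n₂) = fun _ ↦ 0 := by
    intro n₂; funext y; simp [hG_def, h0]
  have G_snd_zero : ∀ n₁ : ℕ, G (n₁, 0) = fun _ ↦ 0 := by
    intro n₁; funext y; simp [hG_def, h0]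
  -- the integral of one term
  have integral_G : ∀ {n₁ : ℕ}, n₁ ≠ 0 → ∀ n₂ : ℕ,
      ∫ y in Ioi (0 : ℝ), G (n₁, n₂) y =
        cuspCoeff f n₁ * cuspCoeff f n₂ *
          ((cutoffW (4 * π ^ 2 * n₁ * n₂ / N) / (4 * π ^ 2 * n₁ * n₂) : ℝ) : ℂ) := by
    intro n₁ h₁ n₂
    have hn₁ : (0 : ℝ) < n₁ := by exact_mod_cast Nat.pos_of_ne_zero h₁
    have hα : (0 : ℝ) < 2 * Real.pi * n₁ := by positivity
    rw [setIntegral_congr_fun measurableSet_Ioi (fun y hy ↦ G_eq (n₁, n₂) hy), integral_const_mul,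
      integral_complex_ofReal, integral_const_mul]
    simp only
    rw [show (fun y : ℝ ↦ Real.exp (-(2 * Real.pi * (n₁ : ℝ)) * y) * Real.exp (-(2 * Real.pi * n₂ / N) / y))
        = fun y : ℝ ↦ Real.exp (-(2 * Real.pi * n₁) * y) * Real.exp (-(2 * Real.pi * n₂ / N) / y) from rfl,
      integral_exp_neg_mul_mul_exp_neg_div hα]
    congr 2
    rcases Nat.eq_zero_or_pos n₂ with rfl | h₂
    · simp
    · have hn₂ : (0 : ℝ) < n₂ := by exact_mod_cast h₂
      rw [show 2 * Real.pi * (n₁ : ℝ) * (2 * Real.pi * n₂ / N) = 4 * π ^ 2 * n₁ * n₂ / N by ring]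
      field_simp
      norm_num
  -- each term is integrable on `(0, ∞)`
  have integrableOn_G : ∀ p : ℕ × ℕ, IntegrableOn (G p) (Ioi 0) := by
    intro p
    rcases Nat.eq_zero_or_pos p.1 with hp | h₁
    · obtain ⟨n₁, n₂⟩ := p
      simp only at hp
      subst hp
      rw [G_fst_zero]
      exact integrableOn_zero
    · have hα : (0 : ℝ) < 2 * Real.pi * p.1 := by positivity
      have hβ : (0 : ℝ) ≤ 2 * Real.pi * p.2 / N := by positivity
      have hint : IntegrableOn (fun y : ℝ ↦ cuspCoeff f p.1 * cuspCoeff f p.2 *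
          (((2 * Real.pi * p.2)⁻¹ *
            (Real.exp (-(2 * Real.pi * p.1) * y) * Real.exp (-(2 * Real.pi * p.2 / N) / y)) : ℝ) : ℂ))
          (Ioi 0) :=
        ((integrableOn_exp_neg_mul_mul_exp_neg_div hα hβ).const_mul
          ((2 * Real.pi * (p.2 : ℝ))⁻¹)).ofReal.const_mul (cuspCoeff f p.1 * cuspCoeff f p.2)
      exact hint.congr_fun (fun y hy ↦ (G_eq p hy).symm) measurableSet_Ioi
  -- the `L¹` norm of one term
  have integral_norm_G : ∀ {n₁ : ℕ}, n₁ ≠ 0 → ∀ n₂ : ℕ,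
      ∫ y in Ioi (0 : ℝ), ‖G (n₁, n₂) y‖ =
        ‖cuspCoeff f n₁‖ * ‖cuspCoeff f n₂‖ *
          (cutoffW (4 * π ^ 2 * n₁ * n₂ / N) / (4 * π ^ 2 * n₁ * n₂)) := by
    intro n₁ h₁ n₂
    have hn₁ : (0 : ℝ) < n₁ := by exact_mod_cast Nat.pos_of_ne_zero h₁
    have hα : (0 : ℝ) < 2 * Real.pi * n₁ := by positivity
    have hnorm : ∀ y ∈ Ioi (0 : ℝ), ‖G (n₁, n₂) y‖ = ‖cuspCoeff f n₁‖ * ‖cuspCoeff f n₂‖ *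
        ((2 * Real.pi * n₂)⁻¹ *
          (Real.exp (-(2 * Real.pi * n₁) * y) * Real.exp (-(2 * Real.pi * n₂ / N) / y))) := by
      intro y hy
      rw [G_eq (n₁, n₂) hy, norm_mul, norm_mul, Complex.norm_real, Real.norm_of_nonneg (by positivity)]
    rw [setIntegral_congr_fun measurableSet_Ioi hnorm, integral_const_mul, integral_const_mul,
      integral_exp_neg_mul_mul_exp_neg_div hα]
    rcases Nat.eq_zero_or_pos n₂ with rfl | h₂
    · simp
    · have hn₂ : (0 : ℝ) < n₂ := by exact_mod_cast h₂
      rw [show 2 * Real.pi * (n₁ : ℝ) * (2 * Real.pi * n₂ / N) = 4 * π ^ 2 * n₁ * n₂ / N by ring]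
      field_simp
      norm_num
  -- summability of the `L¹` norms over `ℕ × ℕ`
  have summable_norm_G : Summable fun p : ℕ × ℕ ↦ ∫ y in Ioi (0 : ℝ), ‖G p y‖ := by
    -- `b n = ‖a_n‖ / n³` (with `b 0 = 0`) is summable (Hecke's bound: `L(f,3)` converges absolutely)
    set b : ℕ → ℝ := fun n ↦ ‖LSeries.term (cuspCoeff f) 3 n‖ with hb
    have hbs : Summable b := (LSeriesSummable_cuspCoeff_gamma0 f (s := 3) (by norm_num)).norm
    have hb_eq : ∀ n : ℕ, n ≠ 0 → b n = ‖cuspCoeff f n‖ / (n : ℝ) ^ 3 := by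
      intro n hn
      simp only [hb, LSeries.norm_term_eq, hn, if_false]
      norm_num
    have hb0 : b 0 = 0 := by simp [hb, LSeries.norm_term_eq]
    have hprod : Summable fun p : ℕ × ℕ ↦ b p.1 * b p.2 :=
      summable_mul_of_summable_norm (f := b) (g := b)
        (hbs.norm.congr fun n ↦ by simp) (hbs.norm.congr fun n ↦ by simp)
    refine (hprod.mul_left (3 * (N : ℝ) ^ 2 / (4 * π ^ 6))).of_nonneg_of_le
      (fun p ↦ integral_nonneg fun y ↦ norm_nonneg _) fun p ↦ ?_
    obtain ⟨n₁, n₂⟩ := p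
    rcases Nat.eq_zero_or_pos n₁ with rfl | h₁
    · simp only [G_fst_zero, norm_zero, integral_zero, hb0, zero_mul, mul_zero]
      exact le_refl _
    rcases Nat.eq_zero_or_pos n₂ with rfl | h₂
    · simp only [G_snd_zero, norm_zero, integral_zero, hb0, mul_zero]
      exact le_refl _
    have hn₁ : (0 : ℝ) < n₁ := by exact_mod_cast h₁
    have hn₂ : (0 : ℝ) < n₂ := by exact_mod_cast h₂
    simp only
    rw [integral_norm_G (Nat.pos_iff_ne_zero.mp h₁) n₂, hb_eq n₁ (Nat.pos_iff_ne_zero.mp h₁),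
      hb_eq n₂ (Nat.pos_iff_ne_zero.mp h₂)]
    have hy : (0 : ℝ) < 4 * π ^ 2 * n₁ * n₂ / N := by positivity
    have hW := cutoffW_le_div_sq hy
    -- `W(4π²n₁n₂/N)/(4π²n₁n₂) ≤ 48 N²/((4π²n₁n₂)² · 4π²n₁n₂) = 3N²/(4π⁶ n₁³ n₂³)`
    calc ‖cuspCoeff f n₁‖ * ‖cuspCoeff f n₂‖ * (cutoffW (4 * π ^ 2 * n₁ * n₂ / N) / (4 * π ^ 2 * n₁ * n₂))
        ≤ ‖cuspCoeff f n₁‖ * ‖cuspCoeff f n₂‖ *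
            ((48 / (4 * π ^ 2 * n₁ * n₂ / N) ^ 2) / (4 * π ^ 2 * n₁ * n₂)) := by gcongr
      _ = 3 * (N : ℝ) ^ 2 / (4 * π ^ 6) * (‖cuspCoeff f n₁‖ / (n₁ : ℝ) ^ 3 * (‖cuspCoeff f n₂‖ / (n₂ : ℝ) ^ 3)) := by
          field_simp
          ring
  -- pointwise: for `y > 0` the double series sums to `f(iy) · ∫_{v > 1/(Ny)} f(iv) dv`
  have hasSum_G : ∀ {y : ℝ}, 0 < y → HasSum (fun p : ℕ × ℕ ↦ G p y)
      (f (UpperHalfPlane.ofComplex (Complex.I * y)) *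
        ∫ v in Ioi (((N : ℝ) * y)⁻¹), f (UpperHalfPlane.ofComplex (Complex.I * v))) := by
    intro y hy
    have hc : 0 < ((N : ℝ) * y)⁻¹ := by positivity
    have hF := hasSum_imagAxis one_mem_strictPeriods_Gamma0 f hy
    have hT := hasSum_integral_Ioi_imagAxis one_mem_strictPeriods_Gamma0 f hc
    have hFn : Summable fun n : ℕ ↦ ‖cuspCoeff f n * (Real.exp (-(2 * Real.pi * n) * y) : ℝ)‖ := by
      refine (summable_norm_cuspCoeff_mul_exp one_mem_strictPeriods_Gamma0 f hy).congr fun n ↦ ?_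
      rw [norm_mul, Complex.norm_real, Real.norm_of_nonneg (Real.exp_pos _).le]
      ring_nf
    have hTn : Summable fun n : ℕ ↦
        ‖cuspCoeff f n * (Real.exp (-(2 * Real.pi * n) * ((N : ℝ) * y)⁻¹) / (2 * Real.pi * n) : ℝ)‖ := by
      refine (summable_norm_cuspCoeff_mul_exp_div one_mem_strictPeriods_Gamma0 f hc).congr fun n ↦ ?_
      rw [norm_mul, Complex.norm_real, Real.norm_of_nonneg (by positivity)]
    have h := hF.mul hT (summable_mul_of_summable_norm
      (f := fun n : ℕ ↦ cuspCoeff f n * (Real.exp (-(2 * Real.pi * n) * y) : ℝ))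
      (g := fun n : ℕ ↦ cuspCoeff f n *
        (Real.exp (-(2 * Real.pi * n) * ((N : ℝ) * y)⁻¹) / (2 * Real.pi * n) : ℝ)) hFn hTn)
    simp only [hG_def]
    exact h
  -- exchange sum and integral
  have hmain := hasSum_integral_of_summable_integral_norm (μ := volume.restrict (Ioi (0 : ℝ)))
    (F := fun p y ↦ G p y) (fun p ↦ integrableOn_G p) summable_norm_G
  have heq : ∫ y in Ioi (0 : ℝ), (∑' p : ℕ × ℕ, G p y) =
      ∫ y in Ioi (0 : ℝ), f (UpperHalfPlane.ofComplex (Complex.I * y)) *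
        ∫ v in Ioi (((N : ℝ) * y)⁻¹), f (UpperHalfPlane.ofComplex (Complex.I * v)) :=
    setIntegral_congr_fun measurableSet_Ioi fun y hy ↦ (hasSum_G hy).tsum_eq
  rw [heq] at hmain
  -- identify the terms: `afeSqTerm p = 4π² ∫ G p`
  have hterm : ∀ p : ℕ × ℕ, afeSqTerm N f p = 4 * (π : ℂ) ^ 2 * ∫ y in Ioi (0 : ℝ), G p y := by
    rintro ⟨n₁, n₂⟩
    rcases Nat.eq_zero_or_pos n₁ with rfl | h₁
    · rw [afeSqTerm_of_fst_eq_zero, G_fst_zero, integral_zero, mul_zero]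
    rcases Nat.eq_zero_or_pos n₂ with rfl | h₂
    · rw [afeSqTerm_of_snd_eq_zero, G_snd_zero, integral_zero, mul_zero]
    rw [afeSqTerm_eq_of_ne_zero f h₁.ne' h₂.ne', integral_G h₁.ne' n₂]
    have hπ : (π : ℂ) ≠ 0 := by exact_mod_cast Real.pi_pos.ne'
    have hn₁' : (n₁ : ℂ) ≠ 0 := by exact_mod_cast h₁.ne'
    have hn₂' : (n₂ : ℂ) ≠ 0 := by exact_mod_cast h₂.ne'
    push_cast
    field_simp
  have hfun : afeSqTerm N f = fun p ↦ 4 * (π : ℂ) ^ 2 * ∫ y in Ioi (0 : ℝ), G p y :=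
    funext hterm
  rw [hfun]
  exact hmain.mul_left _

/-- Stub **S4** of the fact skeleton `fricke-real-split` (crux workfile
`Cruxes/BeyondDiagonalBeatsQuarter/Lines/fricke_real_split.lean` on stmt-Parity-20343), in its registered
quantifier shape. [cite: KowalskiMichelVanderKam2000, (21)–(22) p. 12] -/
theorem hasSum_afeSqTerm_all :
    ∀ (N : ℕ) [NeZero N] (f : CuspForm (Gamma0 N) 2),
      HasSum (afeSqTerm N f)
        (4 * (π : ℂ) ^ 2 *
          ∫ y in Ioi (0 : ℝ), f (UpperHalfPlane.ofComplex (Complex.I * y)) *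
            ∫ v in Ioi (((N : ℝ) * y)⁻¹), f (UpperHalfPlane.ofComplex (Complex.I * v))) :=
  fun _ _ f ↦ hasSum_afeSqTerm f

end Literature.NumberTheory.LFunctions.KMV2000

end
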